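import Summits.FinalStateConjecture.FinalStateConjecture.Theorems.PhotonSphereChannelsWindowedShellChannelsStubLayerSplitTransition

/-!
# Crux `WindowedShellChannels` (stmt-FinalStateConjecture-14085), line `Sketch` — stub `stub_layerSplit`,
# part 2: the four cutoffs of the layer split

Support file for `stub_layerSplit σ`.  For a scale `L > 0` and a ratio `Λ ≥ 20` the smooth
partition of unity `χz + χn + χf + χg = 1` of the line (`S = Real.smoothTransition`):

* ZONE `χz(x) = S(x/L + 2)·S(2 − x/L)` (part 1): `= 1` on `[−L, L]`, `= 0` off `(−2L, 2L)`;
* NEAR `χn(x) = S(−1 − x/(10L))`: `= 1` on `(−∞, −20L]`, `= 0` on `[−10L, ∞)`, `|χn′| ≤ 1/(5L)`;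
* FAR `χf(x) = S(2x/(ΛL) − 1)`: `= 0` on `(−∞, ΛL/2]`, `= 1` on `[ΛL, ∞)`, `|χf′| ≤ 4/(ΛL)`;
* GAP `χg = 1 − χz − χn − χf`, supported in the open layer `{L < |x| < ΛL}`.

The three transitions `L < |x| < 2L`, `−20L < x < −10L`, `ΛL/2 < x < ΛL` are pairwise disjoint
and lie in the layer, each derivative is `≤ 4/|x|` in absolute value where it does not vanish, so
`χz′² + χn′² + χf′² ≤ 16/x²` and `χg′² = (χz′ + χn′ + χf′)² ≤ 16/x²` everywhere, and all four
derivatives vanish off the layer.  Everything is exported existentially in `exists_layerCutoffs`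
(no definitions). [folklore]
-/

noncomputable section

set_option linter.dupNamespace false

namespace Summit.FinalStateConjecture.FinalStateConjecture.Theorems.WindowedShellChannelsSketch

namespace LayerSplit

open Real Set Literature.Analysis.Calculus

/-! ### The near cutoff `χn(x) = S(−1 − x/(10L))` -/

section Near

variable {χn : ℝ → ℝ} {L x : ℝ}

/-- `χn = 1` on `(−∞, −20L]`. [folklore] -/
theorem chiN_eq_one (hn : χn = fun x => smoothTransition (-1 - x / (10 * L))) (hL : 0 < L)
    (hx : x ≤ -(20 * L)) : χn x = 1 := by
  subst hn
  have h3 : x / (10 * L) ≤ -2 := by rw [div_le_iff₀ (by positivity)]; linarith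
  exact smoothTransition.one_of_one_le (by linarith)

/-- `χn = 0` on `[−10L, ∞)`. [folklore] -/
theorem chiN_eq_zero (hn : χn = fun x => smoothTransition (-1 - x / (10 * L))) (hL : 0 < L)
    (hx : -(10 * L) ≤ x) : χn x = 0 := by
  subst hn
  have h3 : -1 ≤ x / (10 * L) := by rw [le_div_iff₀ (by positivity)]; linarith
  exact smoothTransition.zero_of_nonpos (by linarith)

/-- The derivative of `χn`. [folklore] -/
theorem hasDerivAt_chiN (hn : χn = fun x => smoothTransition (-1 - x / (10 * L))) (x : ℝ) :
    HasDerivAt χn (deriv smoothTransition (-1 - x / (10 * L)) * (-(1 / (10 * L)))) x := by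
  subst hn
  have h1 : HasDerivAt (fun y : ℝ => -1 - y / (10 * L)) (-(1 / (10 * L))) x :=
    ((hasDerivAt_id' x).div_const (10 * L)).const_sub (-1)
  exact ((differentiable_smoothTransition _).hasDerivAt).comp x h1

/-- The derivative of `χn`, `deriv` form. [folklore] -/
theorem deriv_chiN (hn : χn = fun x => smoothTransition (-1 - x / (10 * L))) (x : ℝ) :
    deriv χn x = -(deriv smoothTransition (-1 - x / (10 * L)) / (10 * L)) := by
  rw [(hasDerivAt_chiN hn x).deriv]; ring

/-- `|χn′| ≤ 1/(5L)`. [folklore] -/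
theorem abs_deriv_chiN_le (hn : χn = fun x => smoothTransition (-1 - x / (10 * L))) (hL : 0 < L)
    (x : ℝ) : |deriv χn x| ≤ 1 / (5 * L) := by
  rw [deriv_chiN hn, abs_neg, abs_div, abs_of_pos (by positivity : (0:ℝ) < 10 * L),
    div_le_div_iff₀ (by positivity) (by positivity)]
  have := abs_deriv_smoothTransition_le_two (-1 - x / (10 * L))
  nlinarith

/-- `χn′ = 0` off the transition `−20L < x < −10L`. [folklore] -/
theorem deriv_chiN_eq_zero (hn : χn = fun x => smoothTransition (-1 - x / (10 * L))) (hL : 0 < L)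
    (hx : x ≤ -(20 * L) ∨ -(10 * L) ≤ x) : deriv χn x = 0 := by
  rw [deriv_chiN hn]
  have key : -1 - x / (10 * L) ≤ 0 ∨ 1 ≤ -1 - x / (10 * L) := by
    rcases hx with hx | hx
    · right
      have h3 : x / (10 * L) ≤ -2 := by rw [div_le_iff₀ (by positivity)]; linarith
      linarith
    · left
      have h3 : -1 ≤ x / (10 * L) := by rw [le_div_iff₀ (by positivity)]; linarith
      linarith
  rw [key.elim deriv_smoothTransition_of_nonpos deriv_smoothTransition_of_one_le]; ring

/-- `χn′(x) ≠ 0` only on the transition. [folklore] -/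
theorem trans_of_deriv_chiN_ne_zero (hn : χn = fun x => smoothTransition (-1 - x / (10 * L)))
    (hL : 0 < L) (h : deriv χn x ≠ 0) : -(20 * L) < x ∧ x < -(10 * L) := by
  by_contra hc
  rw [not_and_or, not_lt, not_lt] at hc
  exact h (deriv_chiN_eq_zero hn hL hc)

/-- **`χn′² ≤ 16/x²`** everywhere. [folklore] -/
theorem deriv_chiN_sq_le (hn : χn = fun x => smoothTransition (-1 - x / (10 * L))) (hL : 0 < L)
    (x : ℝ) : deriv χn x ^ 2 ≤ 16 / x ^ 2 := by
  by_cases h : deriv χn x = 0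
  · rw [h, sq, mul_zero]; positivity
  · obtain ⟨h1, h2⟩ := trans_of_deriv_chiN_ne_zero hn hL h
    have hx0 : x ≠ 0 := by intro h0; rw [h0] at h2; linarith
    have hxa : |x| ≤ 20 * L := by rw [abs_of_neg (by linarith)]; linarith
    have e : 1 / (5 * L) * (20 * L) = 4 := by field_simp; ring
    exact sq_le_sixteen_div_sq (abs_deriv_chiN_le hn hL x) hxa e.le hx0

end Near

/-! ### The far cutoff `χf(x) = S(2x/(ΛL) − 1)` -/

section Far

variable {χf : ℝ → ℝ} {Λ L x : ℝ}

/-- `χf = 1` on `[ΛL, ∞)`. [folklore] -/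
theorem chiF_eq_one (hf : χf = fun x => smoothTransition (2 * x / (Λ * L) - 1)) (hL : 0 < L)
    (hΛ : 0 < Λ) (hx : Λ * L ≤ x) : χf x = 1 := by
  subst hf
  have h3 : 2 ≤ 2 * x / (Λ * L) := by rw [le_div_iff₀ (by positivity)]; linarith
  exact smoothTransition.one_of_one_le (by linarith)

/-- `χf = 0` on `(−∞, ΛL/2]`. [folklore] -/
theorem chiF_eq_zero (hf : χf = fun x => smoothTransition (2 * x / (Λ * L) - 1)) (hL : 0 < L)
    (hΛ : 0 < Λ) (hx : x ≤ Λ * L / 2) : χf x = 0 := by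
  subst hf
  have h3 : 2 * x / (Λ * L) ≤ 1 := by rw [div_le_iff₀ (by positivity)]; linarith
  exact smoothTransition.zero_of_nonpos (by linarith)

/-- The derivative of `χf`. [folklore] -/
theorem hasDerivAt_chiF (hf : χf = fun x => smoothTransition (2 * x / (Λ * L) - 1)) (x : ℝ) :
    HasDerivAt χf (deriv smoothTransition (2 * x / (Λ * L) - 1) * (2 / (Λ * L))) x := by
  subst hf
  have h1 : HasDerivAt (fun y : ℝ => 2 * y / (Λ * L) - 1) (2 * 1 / (Λ * L)) x :=
    (((hasDerivAt_id' x).const_mul 2).div_const (Λ * L)).sub_const 1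
  have h1' : HasDerivAt (fun y : ℝ => 2 * y / (Λ * L) - 1) (2 / (Λ * L)) x :=
    h1.congr_deriv (by ring)
  exact ((differentiable_smoothTransition _).hasDerivAt).comp x h1'

/-- The derivative of `χf`, `deriv` form. [folklore] -/
theorem deriv_chiF (hf : χf = fun x => smoothTransition (2 * x / (Λ * L) - 1)) (x : ℝ) :
    deriv χf x = 2 * deriv smoothTransition (2 * x / (Λ * L) - 1) / (Λ * L) := by
  rw [(hasDerivAt_chiF hf x).deriv]; ring

/-- `|χf′| ≤ 4/(ΛL)`. [folklore] -/
theorem abs_deriv_chiF_le (hf : χf = fun x => smoothTransition (2 * x / (Λ * L) - 1)) (hL : 0 < L)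
    (hΛ : 0 < Λ) (x : ℝ) : |deriv χf x| ≤ 4 / (Λ * L) := by
  rw [deriv_chiF hf, abs_div, abs_mul, abs_of_pos (by positivity : (0:ℝ) < Λ * L), abs_two]
  refine div_le_div_of_nonneg_right ?_ (by positivity)
  have := abs_deriv_smoothTransition_le_two (2 * x / (Λ * L) - 1)
  linarith

/-- `χf′ = 0` off the transition `ΛL/2 < x < ΛL`. [folklore] -/
theorem deriv_chiF_eq_zero (hf : χf = fun x => smoothTransition (2 * x / (Λ * L) - 1)) (hL : 0 < L)
    (hΛ : 0 < Λ) (hx : x ≤ Λ * L / 2 ∨ Λ * L ≤ x) : deriv χf x = 0 := by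
  rw [deriv_chiF hf]
  have key : 2 * x / (Λ * L) - 1 ≤ 0 ∨ 1 ≤ 2 * x / (Λ * L) - 1 := by
    rcases hx with hx | hx
    · left
      have h3 : 2 * x / (Λ * L) ≤ 1 := by rw [div_le_iff₀ (by positivity)]; linarith
      linarith
    · right
      have h3 : 2 ≤ 2 * x / (Λ * L) := by rw [le_div_iff₀ (by positivity)]; linarith
      linarith
  rw [key.elim deriv_smoothTransition_of_nonpos deriv_smoothTransition_of_one_le]; ring

/-- `χf′(x) ≠ 0` only on the transition. [folklore] -/
theorem trans_of_deriv_chiF_ne_zero (hf : χf = fun x => smoothTransition (2 * x / (Λ * L) - 1))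
    (hL : 0 < L) (hΛ : 0 < Λ) (h : deriv χf x ≠ 0) : Λ * L / 2 < x ∧ x < Λ * L := by
  by_contra hc
  rw [not_and_or, not_lt, not_lt] at hc
  exact h (deriv_chiF_eq_zero hf hL hΛ hc)

/-- **`χf′² ≤ 16/x²`** everywhere. [folklore] -/
theorem deriv_chiF_sq_le (hf : χf = fun x => smoothTransition (2 * x / (Λ * L) - 1)) (hL : 0 < L)
    (hΛ : 0 < Λ) (x : ℝ) : deriv χf x ^ 2 ≤ 16 / x ^ 2 := by
  by_cases h : deriv χf x = 0
  · rw [h, sq, mul_zero]; positivity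
  · obtain ⟨h1, h2⟩ := trans_of_deriv_chiF_ne_zero hf hL hΛ h
    have hpos : 0 < x := lt_trans (by positivity) h1
    have hxa : |x| ≤ Λ * L := by rw [abs_of_pos hpos]; exact h2.le
    exact sq_le_sixteen_div_sq (abs_deriv_chiF_le hf hL hΛ x) hxa
      (div_mul_cancel₀ (4:ℝ) (ne_of_gt (by positivity))).le hpos.ne'

end Far

/-! ### The three transitions together and the gap cutoff -/

section Together

variable {χz χn χf : ℝ → ℝ} {Λ L x : ℝ}
  (hz : χz = fun x => smoothTransition (x / L + 2) * smoothTransition (2 - x / L))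
  (hn : χn = fun x => smoothTransition (-1 - x / (10 * L)))
  (hf : χf = fun x => smoothTransition (2 * x / (Λ * L) - 1))
  (hL : 0 < L) (hΛ : 20 ≤ Λ)
include hz hn hf hL hΛ

/-- `χz + χn + χf ≤ 1` (at every point at most one of them is nonzero). [folklore] -/
theorem sum_three_le_one (x : ℝ) : χz x + χn x + χf x ≤ 1 := by
  have hΛ0 : 0 < Λ := by linarith
  rcases le_or_gt x (-(2 * L)) with h1 | h1
  · rw [chiZ_eq_zero hz hL (by rw [abs_of_neg (by linarith)]; linarith),
      chiF_eq_zero hf hL hΛ0 (by nlinarith), zero_add, add_zero]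
    exact hn ▸ smoothTransition.le_one _
  rcases lt_or_ge x (Λ * L / 2) with h2 | h2
  · rw [chiN_eq_zero hn hL (by linarith), chiF_eq_zero hf hL hΛ0 h2.le, add_zero, add_zero]
    exact chiZ_le_one hz x
  · rw [chiZ_eq_zero hz hL (by rw [abs_of_pos (by nlinarith)]; nlinarith),
      chiN_eq_zero hn hL (by nlinarith), zero_add, zero_add]
    exact hf ▸ smoothTransition.le_one _

/-- The gap cutoff `1 − χz − χn − χf` vanishes on `[−L, L]`. [folklore] -/
theorem gap_eq_zero_of_le (hx : |x| ≤ L) : 1 - χz x - χn x - χf x = 0 := by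
  have hΛ0 : 0 < Λ := by linarith
  obtain ⟨h1, h2⟩ := abs_le.1 hx
  rw [chiZ_eq_one hz hL hx, chiN_eq_zero hn hL (by linarith), chiF_eq_zero hf hL hΛ0 (by nlinarith)]
  ring

/-- The gap cutoff vanishes on `{ΛL ≤ |x|}`. [folklore] -/
theorem gap_eq_zero_of_ge (hx : Λ * L ≤ |x|) : 1 - χz x - χn x - χf x = 0 := by
  have hΛ0 : 0 < Λ := by linarith
  rcases le_abs'.1 hx with h | h
  · rw [chiZ_eq_zero hz hL (by rw [abs_of_neg (by nlinarith)]; nlinarith),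
      chiN_eq_one hn hL (by nlinarith), chiF_eq_zero hf hL hΛ0 (by nlinarith)]
    ring
  · rw [chiZ_eq_zero hz hL (by rw [abs_of_pos (by nlinarith)]; nlinarith),
      chiN_eq_zero hn hL (by nlinarith), chiF_eq_one hf hL hΛ0 h]
    ring

/-- **The derivative bound of the partition**: `χz′² + χn′² + χf′² ≤ 16/x²` and
`(χz′ + χn′ + χf′)² ≤ 16/x²` (at most one transition is active at each point). [folklore] -/
theorem deriv_sq_sum_le (x : ℝ) :
    deriv χz x ^ 2 + deriv χn x ^ 2 + deriv χf x ^ 2 ≤ 16 / x ^ 2 ∧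
      (deriv χz x + deriv χn x + deriv χf x) ^ 2 ≤ 16 / x ^ 2 := by
  have hΛ0 : 0 < Λ := by linarith
  have hz2 := deriv_chiZ_sq_le hz hL x
  have hn2 := deriv_chiN_sq_le hn hL x
  have hf2 := deriv_chiF_sq_le hf hL hΛ0 x
  by_cases h1 : deriv χn x = 0
  · by_cases h2 : deriv χf x = 0
    · rw [h1, h2]; simpa using hz2
    · obtain ⟨h3, h4⟩ := trans_of_deriv_chiF_ne_zero hf hL hΛ0 h2
      have h5 : deriv χz x = 0 :=
        deriv_chiZ_eq_zero hz hL (Or.inr (by rw [abs_of_pos (by nlinarith)]; nlinarith))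
      rw [h1, h5]; simpa using hf2
  · obtain ⟨h3, h4⟩ := trans_of_deriv_chiN_ne_zero hn hL h1
    have h5 : deriv χz x = 0 :=
      deriv_chiZ_eq_zero hz hL (Or.inr (by rw [abs_of_neg (by linarith)]; linarith))
    have h6 : deriv χf x = 0 := deriv_chiF_eq_zero hf hL hΛ0 (Or.inl (by nlinarith))
    rw [h5, h6]; simpa using hn2

/-- Off the open layer `{L < |x| < ΛL}` the three cutoffs are locally constant. [folklore] -/
theorem deriv_eq_zero_off_layer (hx : ¬(L < |x| ∧ |x| < Λ * L)) :
    deriv χz x = 0 ∧ deriv χn x = 0 ∧ deriv χf x = 0 := by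
  have hΛ0 : 0 < Λ := by linarith
  refine ⟨?_, ?_, ?_⟩
  · by_contra h
    obtain ⟨h1, h2⟩ := trans_of_deriv_chiZ_ne_zero hz hL h
    exact hx ⟨h1, by nlinarith⟩
  · by_contra h
    obtain ⟨h1, h2⟩ := trans_of_deriv_chiN_ne_zero hn hL h
    rw [abs_of_neg (by linarith)] at hx
    exact hx ⟨by linarith, by nlinarith⟩
  · by_contra h
    obtain ⟨h1, h2⟩ := trans_of_deriv_chiF_ne_zero hf hL hΛ0 h
    have hpos : 0 < x := lt_trans (by positivity) h1
    rw [abs_of_pos hpos] at hx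
    exact hx ⟨by nlinarith, h2⟩

omit hL hΛ in
/-- The derivative of the gap cutoff. [folklore] -/
theorem hasDerivAt_gap (x : ℝ) :
    HasDerivAt (fun y => 1 - χz y - χn y - χf y) (-(deriv χz x + deriv χn x + deriv χf x)) x := by
  have h : HasDerivAt (fun y => 1 - χz y - χn y - χf y)
      (0 - deriv χz x - deriv χn x - deriv χf x) x :=
    (((hasDerivAt_const x (1:ℝ)).sub (hasDerivAt_chiZ hz x).differentiableAt.hasDerivAt).sub
      (hasDerivAt_chiN hn x).differentiableAt.hasDerivAt).sub
        (hasDerivAt_chiF hf x).differentiableAt.hasDerivAt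
  have e : (0 - deriv χz x - deriv χn x - deriv χf x) = -(deriv χz x + deriv χn x + deriv χf x) := by
    ring
  rw [← e]
  exact h

end Together

end LayerSplit

open LayerSplit Real in
/-- **The cutoffs of the layer split** (registered principal fact of this support file; stub
`stub_layerSplit`, line `Sketch`).  For `L > 0`, `Λ ≥ 20` there are smooth `χz, χn, χf, χg` with
`χz + χn + χf + χg = 1`, `0 ≤ χz, χn, χf`, `χz + χn + χf ≤ 1`, `χz = 0` off `(−2L, 2L)`, `χn = 0`
on `[−10L, ∞)`, `χf = 0` on `(−∞, ΛL/2]`, `χg = 0` off the open layer `{L < |x| < ΛL}`,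
`χz′² + χn′² + χf′² ≤ 16/x²`, `χg′² ≤ 16/x²`, and all four derivatives vanish off the layer.
[folklore] -/
theorem exists_layerCutoffs : ∀ (Λ L : ℝ), 0 < L → 20 ≤ Λ → ∃ χz χn χf χg : ℝ → ℝ,
    ContDiff ℝ (⊤ : ℕ∞) χz ∧ ContDiff ℝ (⊤ : ℕ∞) χn ∧ ContDiff ℝ (⊤ : ℕ∞) χf ∧ ContDiff ℝ (⊤ : ℕ∞) χg ∧
    (∀ x, χz x + χn x + χf x + χg x = 1) ∧
    (∀ x, 0 ≤ χz x ∧ 0 ≤ χn x ∧ 0 ≤ χf x ∧ χz x + χn x + χf x ≤ 1) ∧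
    (∀ x, 2 * L ≤ |x| → χz x = 0) ∧ (∀ x, -(10 * L) ≤ x → χn x = 0) ∧
    (∀ x, x ≤ Λ * L / 2 → χf x = 0) ∧ (∀ x, ¬(L < |x| ∧ |x| < Λ * L) → χg x = 0) ∧
    (∀ x, deriv χz x ^ 2 + deriv χn x ^ 2 + deriv χf x ^ 2 ≤ 16 / x ^ 2 ∧
      deriv χg x ^ 2 ≤ 16 / x ^ 2) ∧
    (∀ x, ¬(L < |x| ∧ |x| < Λ * L) →
      deriv χz x = 0 ∧ deriv χn x = 0 ∧ deriv χf x = 0 ∧ deriv χg x = 0) := by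
  intro Λ L hL hΛ
  have hΛ0 : 0 < Λ := by linarith
  set χz : ℝ → ℝ := fun x => smoothTransition (x / L + 2) * smoothTransition (2 - x / L) with hz
  set χn : ℝ → ℝ := fun x => smoothTransition (-1 - x / (10 * L)) with hn
  set χf : ℝ → ℝ := fun x => smoothTransition (2 * x / (Λ * L) - 1) with hf
  set χg : ℝ → ℝ := fun x => 1 - χz x - χn x - χf x with hg
  have hCz : ContDiff ℝ (⊤ : ℕ∞) χz := contDiff_chiZ hz
  have hCn : ContDiff ℝ (⊤ : ℕ∞) χn :=
    hn ▸ smoothTransition.contDiff.comp (contDiff_const.sub (contDiff_id.div_const _))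
  have hCf : ContDiff ℝ (⊤ : ℕ∞) χf :=
    hf ▸ smoothTransition.contDiff.comp (((contDiff_const.mul contDiff_id).div_const _).sub contDiff_const)
  have hCg : ContDiff ℝ (⊤ : ℕ∞) χg := ((contDiff_const.sub hCz).sub hCn).sub hCf
  have hdg : ∀ x, deriv χg x = -(deriv χz x + deriv χn x + deriv χf x) := fun x =>
    (hasDerivAt_gap hz hn hf x).deriv
  refine ⟨χz, χn, χf, χg, hCz, hCn, hCf, hCg, fun x => by simp only [hg]; ring, fun x => ?_,
    fun x hx => chiZ_eq_zero hz hL hx, fun x hx => chiN_eq_zero hn hL hx,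
    fun x hx => chiF_eq_zero hf hL hΛ0 hx, fun x hx => ?_, fun x => ?_, fun x hx => ?_⟩
  · exact ⟨chiZ_nonneg hz x, hn ▸ smoothTransition.nonneg _, hf ▸ smoothTransition.nonneg _,
      sum_three_le_one hz hn hf hL hΛ x⟩
  · simp only [not_and_or, not_lt] at hx
    rcases hx with hx | hx
    · exact gap_eq_zero_of_le hz hn hf hL hΛ hx
    · exact gap_eq_zero_of_ge hz hn hf hL hΛ hx
  · obtain ⟨h1, h2⟩ := deriv_sq_sum_le hz hn hf hL hΛ x
    refine ⟨h1, ?_⟩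
    rw [hdg x, neg_sq]
    exact h2
  · obtain ⟨h1, h2, h3⟩ := deriv_eq_zero_off_layer hz hn hf hL hΛ hx
    refine ⟨h1, h2, h3, ?_⟩
    rw [hdg x, h1, h2, h3]; norm_num

end Summit.FinalStateConjecture.FinalStateConjecture.Theorems.WindowedShellChannelsSketch

end
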